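import Summits.CriticalPhenomena.Ising3DConformalLimit.Theorems.IsingEuclidUpgradeR4NonGaussianDefs
import Literature.Probability.LatticeModels.PointwiseScalingLimitTwoPointMono
import HarnessLib

/-!
# Crux `CoulombImpliesNontrivial` (stmt-CriticalPhenomena-13885), line `merging-is-expected-screening`:
# route-posited vocabulary (bookkeeping file, landed before the first stub proof)

Route PerfectScreening (r3), crux decl `Summit.CriticalPhenomena.Ising3DConformalLimit.Theses.PerfectScreening.
CoulombImpliesNontrivial`; line skeleton `Cruxes/CoulombImpliesNontrivial/Lines/merging_is_expected_screening.lean`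
(planner `crux-plan`, lead `prover-line-…-a1`). This file carries, VERBATIM from the checked skeleton, the objects the
three registered stubs `stub_mergeOfScreening` (S1), `stub_doubleClusterCertified` (S2), `stub_capacityScreening` (S3)
are typed in, so that each stub can land as its own `Theorems/` file importing one module (the 0636 precedent is
`IsingEuclidUpgradeR4NonGaussianDefs.lean`):

* §A vocabulary — `InMid z t a` (the middle sup-ball between `z` and `t`, integer form), `midPart L z t T` (the part of
  an obstacle `T ⊆ ℤ³` in that ball, read in the window `box 3 L`), `coulombEnergy A = Σ_{u ≠ v ∈ A} ‖u-v‖⁻¹`,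
  `Certified c₁ C₁ L z t T` (mass `≥ c₁R²` and Coulomb energy `≤ C₁R³` of the middle part, `R = ‖t-z‖`: discrete
  Newtonian capacity `≳ (c₁²/C₁)R`), `depleted L T = Λ_L ∖ T`, `freeTwoPoint Λ β z t = ⟨σ_zσ_t⟩⁰_{Λ,β}` (free b.c.,
  zero field), `Screens κ β L z t T` (`⟨σ_zσ_t⟩⁰_{Λ_L∖T} ≤ (1-κ)⟨σ_zσ_t⟩⁰_{Λ_L}`), `goodEvent c₁ C₁ L x z t` (the cluster
  of `x` in a bond configuration avoids `z,t` and is certified), `lineConfig` (the axial cross `(-e₀,e₀,-e₂,e₂)`);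
* §B glue, all proved: `midPart_congr`, `certified_congr` (the certificate reads `T` only inside `box 3 L`),
  `measurableSet_goodEvent` (the good event is generated by the connection events `{x ↔ a}`), `lineConfig_mem`
  (non-coincident), `lat_lineConfig_axial` (the screened pair `[x₃/δ],[x₂/δ]` is axial), `eventually_le_norm_lat_sub`
  (`‖[x₃/δ]-[x₂/δ]‖ → ∞` along the mesh filter);
* §C the registered bookkeeping stub `stub_screeningVocabulary` (= measurability of the good event, the fact the
  composition `nontrivial_of_stubs` feeds to S1), through which this file lands `--supports stmt-CriticalPhenomena-13885`.

No named fact is introduced; every `def` below is a concrete predicate/object of the free-boundary nearest-neighbour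
Ising model in a box (tree `isingTwoPoint`, `box`, `openCluster`, `latticeApprox`). References: M. Aizenman,
H. Duminil-Copin, Ann. of Math. 194 (2021), App. A (Lemma A.1, Remark A.5) [AizenmanDuminilCopinAnnals2021];
G. Lawler, *Intersections of random walks* (1991), §2.2 (capacity, energy) [Lawler1991]; M. Aizenman, Comm. Math.
Phys. 86 (1982), §1 [Aizenman1982].
-/

noncomputable section

namespace Summit.CriticalPhenomena.Ising3DConformalLimit.Cruxes.CoulombImpliesNontrivial.MergingIsExpectedScreening

open Filter Topology Set MeasureTheory Finset
open Literature.Probability.LatticeModels Literature.Probability.Percolation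
open Summit.CriticalPhenomena.Ising3DConformalLimit.Cruxes.IsingEuclidUpgradeR4NonGaussian.FreeCovarianceDeltaDichotomy
open scoped symmDiff

/-! ## §A. Vocabulary (finite volume: the free box `Λ_L = box 3 L ⊂ ℤ³`; `‖·‖` = sup norm on `Site 3`)

`lat`, `boxG`, `twoCurrentMeet` are the already landed objects of `IsingEuclidUpgradeR4NonGaussianDefs`
(crux 0636), imported and reused, not restated. -/

/-- `a` lies in the MIDDLE BALL between `z` and `t`: `‖a - (z+t)/2‖ ≤ ‖t - z‖/16` (integer form, sup norm).
[folklore] -/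
def InMid (z t a : Site 3) : Prop := 8 * ‖2 • a - z - t‖ ≤ ‖t - z‖

open Classical in
/-- The part of an obstacle `T ⊆ ℤ³` in the middle ball between `z` and `t`, read in the window `box 3 L`
(a finite set of sites). [folklore] -/
def midPart (L : ℕ) (z t : Site 3) (T : Set (Site 3)) : Finset (Site 3) :=
  (box 3 L).filter fun a => InMid z t a ∧ a ∈ T

/-- Discrete Coulomb (Newtonian) energy `Σ_{u ≠ v ∈ A} ‖u - v‖⁻¹` of a finite set of sites.
[cite: Lawler1991, §2.2] -/
def coulombEnergy (A : Finset (Site 3)) : ℝ := ∑ u ∈ A, ∑ v ∈ A.erase u, ‖u - v‖⁻¹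

/-- The (mass, energy) CERTIFICATE of an obstacle `T` at scale `R = ‖t - z‖`: its middle part has at least
`c₁R²` sites and Coulomb energy at most `C₁R³` — whence discrete Newtonian capacity
`Cap ≥ #²/(G₀(0)·# + energy) ≳ (c₁²/C₁)·R`, a MACROSCOPIC-capacity obstacle between `z` and `t` (the two
numbers are the Paley–Zygmund-friendly moments of S2). [cite: Lawler1991, §2.2] -/
def Certified (c₁ C₁ : ℝ) (L : ℕ) (z t : Site 3) (T : Set (Site 3)) : Prop :=
  c₁ * ‖t - z‖ ^ 2 ≤ ((midPart L z t T).card : ℝ) ∧ coulombEnergy (midPart L z t T) ≤ C₁ * ‖t - z‖ ^ 3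

open Classical in
/-- The box with the obstacle removed, `Λ_L ∖ T`; the free-boundary Ising model on it is the model on `Λ_L`
with every bond meeting `T` deleted (the spins of `T` decouple). [cite: AizenmanDuminilCopinAnnals2021, Appendix A, Lemma A.1] -/
def depleted (L : ℕ) (T : Set (Site 3)) : Finset (Site 3) := (box 3 L).filter fun a => a ∉ T

/-- Free-boundary zero-field two-point function `⟨σ_zσ_t⟩⁰_{Λ,β}` of a finite region `Λ ⊂ ℤ³`
(`= boxG L z t` for `Λ = box 3 L`, `β = β_c(3)`). [folklore] -/
def freeTwoPoint (Λ : Finset (Site 3)) (β : ℝ) (z t : Site 3) : ℝ :=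
  isingTwoPoint (zdGraph 3) Λ β 0 .free z t

/-- `T` SCREENS the pair `zt` by the factor `1 - κ` inside the box `Λ_L`:
`⟨σ_zσ_t⟩⁰_{Λ_L ∖ T, β} ≤ (1 - κ)·⟨σ_zσ_t⟩⁰_{Λ_L, β}` (Griffiths II gives this with `κ = 0` always). [folklore] -/
def Screens (κ β : ℝ) (L : ℕ) (z t : Site 3) (T : Set (Site 3)) : Prop :=
  freeTwoPoint (depleted L T) β z t ≤ (1 - κ) * freeTwoPoint (box 3 L) β z t

/-- The GOOD event for the (lifted) trace `ω` of a double current: the cluster of `x` (tree `openCluster`)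
avoids `z` and `t` and is certified at scale `‖t - z‖`. [folklore] -/
def goodEvent (c₁ C₁ : ℝ) (L : ℕ) (x z t : Site 3) : Set (BondConfig (Site 3)) :=
  {ω | z ∉ openCluster ω x ∧ t ∉ openCluster ω x ∧ Certified c₁ C₁ L z t (openCluster ω x)}

/-- The line's configuration: the axial cross `(x₀,x₁,x₂,x₃) = (-e₀, e₀, -e₂, e₂)` — the sourced pair on the
first axis, the screened pair on the third, so that `[x₃/δ] - [x₂/δ]` is AXIAL (Messager–Miracle-Solé
geometry for S3) and the middle ball sits at the origin, at distance `≍ 1/δ` from all four points. [folklore] -/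
def lineConfig : Fin 4 → EuclideanSpace ℝ (Fin 3) :=
  ![-EuclideanSpace.single 0 1, EuclideanSpace.single 0 1, -EuclideanSpace.single 2 1, EuclideanSpace.single 2 1]

/-! ## §B. Glue (all proved) -/

/-- The certificate only reads the obstacle inside the window `box 3 L`. [folklore] -/
theorem midPart_congr {L : ℕ} {z t : Site 3} {T T' : Set (Site 3)}
    (h : ∀ a ∈ box 3 L, a ∈ T ↔ a ∈ T') : midPart L z t T = midPart L z t T' := by
  classical
  unfold midPart
  refine Finset.filter_congr fun a ha => ?_
  rw [h a ha]

/-- … hence so does `Certified`. [folklore] -/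
theorem certified_congr {c₁ C₁ : ℝ} {L : ℕ} {z t : Site 3} {T T' : Set (Site 3)}
    (h : ∀ a ∈ box 3 L, a ∈ T ↔ a ∈ T') : Certified c₁ C₁ L z t T ↔ Certified c₁ C₁ L z t T' := by
  unfold Certified
  rw [midPart_congr h]

/-- The good event is measurable: it is read off the finitely many connection events `{x ↔ a}`,
`a ∈ box 3 L ∪ {z, t}` (each measurable, `measurableSet_openConn_holds`). [folklore] -/
theorem measurableSet_goodEvent (c₁ C₁ : ℝ) (L : ℕ) (x z t : Site 3) :
    MeasurableSet (goodEvent c₁ C₁ L x z t) := by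
  classical
  -- the finite window and the trace of the cluster on it
  set s : Finset (Site 3) := insert z (insert t (box 3 L)) with hs
  let φ : BondConfig (Site 3) → Finset (Site 3) := fun ω => s.filter fun a => a ∈ openCluster ω x
  let good' : Finset (Site 3) → Prop := fun A => z ∉ A ∧ t ∉ A ∧ Certified c₁ C₁ L z t (↑A : Set (Site 3))
  have hzs : z ∈ s := by simp [hs]
  have hts : t ∈ s := by simp [hs]
  have hbs : ∀ a ∈ box 3 L, a ∈ s := fun a ha => by simp [hs, ha]
  -- the event as a countable union of "trace = A" events
  have hrepr : goodEvent c₁ C₁ L x z t = ⋃ A : Finset (Site 3), ({ω | φ ω = A} ∩ {_ω | good' A}) := by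
    ext ω
    simp only [Set.mem_iUnion, Set.mem_inter_iff, Set.mem_setOf_eq]
    constructor
    · intro hω
      refine ⟨φ ω, rfl, ?_⟩
      have hmem : ∀ a ∈ s, (a ∈ (↑(φ ω) : Set (Site 3)) ↔ a ∈ openCluster ω x) := fun a ha => by
        simp [φ, ha]
      refine ⟨fun h => hω.1 ((hmem z hzs).1 h), fun h => hω.2.1 ((hmem t hts).1 h), ?_⟩
      exact (certified_congr fun a ha => (hmem a (hbs a ha)).symm).1 hω.2.2
    · rintro ⟨A, hA, hg⟩
      have hmem : ∀ a ∈ s, (a ∈ (↑A : Set (Site 3)) ↔ a ∈ openCluster ω x) := fun a ha => by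
        rw [← hA]; simp [φ, ha]
      refine ⟨fun h => hg.1 ((hmem z hzs).2 h), fun h => hg.2.1 ((hmem t hts).2 h), ?_⟩
      exact (certified_congr fun a ha => (hmem a (hbs a ha))).1 hg.2.2
  rw [hrepr]
  refine MeasurableSet.iUnion fun A => MeasurableSet.inter ?_ (MeasurableSet.const _)
  -- `{φ = A}` is a countable intersection of Boolean combinations of connection events
  have hrepr2 : {ω : BondConfig (Site 3) | φ ω = A} =
      ⋂ a : Site 3, {ω | a ∈ A ↔ (a ∈ s ∧ ω ∈ openConn x a)} := by
    ext ω
    simp only [Set.mem_setOf_eq, Set.mem_iInter, φ]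
    constructor
    · intro h a
      rw [← h, Finset.mem_filter]
      rfl
    · intro h
      ext a
      rw [Finset.mem_filter, h a]
      rfl
  rw [hrepr2]
  refine MeasurableSet.iInter fun a => ?_
  have hconn : MeasurableSet (openConn x a : Set (BondConfig (Site 3))) := measurableSet_openConn_holds x a
  have hset : {ω : BondConfig (Site 3) | a ∈ A ↔ (a ∈ s ∧ ω ∈ openConn x a)} =
      if a ∈ A then (if a ∈ s then openConn x a else ∅)
      else (if a ∈ s then (openConn x a)ᶜ else Set.univ) := by
    ext ω
    by_cases hA : a ∈ A <;> by_cases ha : a ∈ s <;> simp [hA, ha]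
  rw [hset]
  split_ifs
  exacts [hconn, MeasurableSet.empty, hconn.compl, MeasurableSet.univ]

/-- The axial cross is a non-coincident configuration. [folklore] -/
theorem lineConfig_mem : lineConfig ∈ NonCoincident 3 4 := by
  rw [mem_nonCoincident]
  intro i j hij
  -- read the equality on the coordinates `0` and `2`
  have h0 := congrArg (fun p : EuclideanSpace ℝ (Fin 3) => p 0) hij
  have h2 := congrArg (fun p : EuclideanSpace ℝ (Fin 3) => p 2) hij
  fin_cases i <;> fin_cases j <;> first
    | rfl
    | (exfalso; simp [lineConfig] at h0 h2 <;> linarith)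

/-- The screened pair of the axial cross is axial: `[x₃/δ]` and `[x₂/δ]` differ only in the third coordinate.
[folklore] -/
theorem lat_lineConfig_axial (δ : ℝ) (j : Fin 3) (hj : j ≠ 2) :
    lat δ lineConfig 3 j = lat δ lineConfig 2 j := by
  fin_cases j
  · simp [lat, lineConfig, latticeApprox_apply]
  · simp [lat, lineConfig, latticeApprox_apply]
  · exact absurd rfl hj

/-- Along the mesh filter the lattice points `[x₃/δ]`, `[x₂/δ]` of two distinct macroscopic points drift apart:
eventually `R₀ ≤ ‖[x₃/δ] - [x₂/δ]‖` (`‖p-q‖/δ - 2 ≤ ‖[p/δ]-[q/δ]‖`, tree `le_supNorm_latticeApprox_sub`). [folklore] -/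
theorem eventually_le_norm_lat_sub {x : Fin 4 → EuclideanSpace ℝ (Fin 3)} (hx : x ∈ NonCoincident 3 4)
    (R₀ : ℝ) : ∀ᶠ δ in 𝓝[>] (0:ℝ), R₀ ≤ ‖lat δ x 3 - lat δ x 2‖ := by
  have hinj : Function.Injective x := hx
  set D : ℝ := ‖WithLp.ofLp (x 3) - WithLp.ofLp (x 2)‖ with hD
  have hDpos : 0 < D := by
    rw [hD, norm_pos_iff, sub_ne_zero, (WithLp.ofLp_injective 2).ne_iff]
    exact hinj.ne (by decide)
  have hM : 0 < max R₀ 0 + 2 := by positivity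
  have hmem : Set.Ioc (0:ℝ) (D / (max R₀ 0 + 2)) ∈ 𝓝[>] (0:ℝ) := Ioc_mem_nhdsGT (by positivity)
  filter_upwards [hmem] with δ hδ
  have hδ0 : 0 < δ := hδ.1
  have h1 := le_supNorm_latticeApprox_sub (d := 3) (by norm_num) hδ0 (x 3) (x 2)
  have h2 : max R₀ 0 + 2 ≤ D / δ := by
    rw [le_div_iff₀ hδ0]
    have := hδ.2
    rw [le_div_iff₀ hM] at this
    linarith
  calc R₀ ≤ max R₀ 0 := le_max_left _ _
    _ ≤ D / δ - 2 := by linarith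
    _ ≤ (Site.supNorm (latticeApprox δ (x 3) - latticeApprox δ (x 2)) : ℝ) := h1
    _ = ‖lat δ x 3 - lat δ x 2‖ := (Site.norm_eq_supNorm _).symm

/-! ## §C. Bookkeeping (the registered vocabulary stub through which this file lands `--supports`) -/

/-- **Registered bookkeeping stub `stub_screeningVocabulary`**: the good event of the line is measurable (for every
certificate level, window, source and screened pair) — the hypothesis of S1 that the composition discharges with
`measurableSet_goodEvent`. [folklore] -/
theorem stub_screeningVocabulary :
    ∀ (c₁ C₁ : ℝ) (L : ℕ) (x z t : Site 3), MeasurableSet (goodEvent c₁ C₁ L x z t) :=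
  fun c₁ C₁ L x z t => measurableSet_goodEvent c₁ C₁ L x z t

end Summit.CriticalPhenomena.Ising3DConformalLimit.Cruxes.CoulombImpliesNontrivial.MergingIsExpectedScreening

end
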